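import Summits.Ventures.HodgeRepro2.T5DatumSimilitude
import Summits.Ventures.HodgeRepro2.T5DatumCMField

/-!
# T5CubeTypes — the cube of CM types of a sextic CM field, and Lemma N.2 for the datum's
vertices `111, 100, 101, 110` (Tier-5 sub-step N2)

Fix a **CM frame** `τ : Fin 3 → (K →+* ℂ)` of the sextic CM field `K` (`IsCMFrame`: the six
embeddings `τ ν, conjugate (τ ν)` are pairwise distinct and exhaust `K →+* ℂ` — e.g. the
representatives `τ₁, τ₂, τ₃` of one CM type, T4N §1).  A vertex of the cube of CM types is a
bit-string `b : Fin 3 → Bool` and its CM type is `cubeType τ b = {τ ν | b ν} ∪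
{conjugate (τ ν) | ¬ b ν}` (`isCMType_cubeType`).  With the datum's bit-strings
`t111, t100, t101, t110` of `T5DatumSimilitude` this gives the four vertex types of
route/T5-N2-route-3.md N2.1, and:

* `sameFlip_cubeType`: the flip pattern of two vertex pairs is equal as soon as the bit-wise
  `xor`s agree — for the datum, `T5DatumSimilitude.xor_consistency` (`111 xor 101 = 100 xor
  110`), so `SameFlip (cubeType τ t111) (cubeType τ t101) (cubeType τ t100) (cubeType τ t110)`
  (`sameFlip_datum`);
* **`lemma_N2_datum`**: Lemma N.2 for the datum's vertices — admissible `e₁₁₁, e₁₀₀` give a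
  totally real `u ≠ 0` with `u e₁₁₁` admissible for `101`, `u⁻¹ e₁₀₀` admissible for `110`,
  `(u e₁₁₁)(u⁻¹ e₁₀₀) = e₁₁₁ e₁₀₀`, and `Re τ(u) < 0` exactly at `τ₂` and its conjugate — the
  sign vector `(+, −, +)` of the record;
* `signVecOf` / `signature_datum`: row N2.2.6 on the field — the sign vector of an admissible
  element at the frame's places is its vertex's bit-string, so both pairs of the datum have the
  signatures `(0,2), (1,1), (1,1)` (`T5DatumSimilitude.signature_A / _B`).

No Literature fact is asserted; the three files together carry Lemma N.2 (sign part) from the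
bit-string model to the CM field.
-/

namespace Summit.Ventures.HodgeRepro2.T5CubeTypes

open NumberField NumberField.ComplexEmbedding
open Summit.Ventures.HodgeRepro2.T5DatumCMField

variable {K : Type*} [Field K]

/-- A CM frame: three embeddings whose conjugate pairs are distinct and exhaust all embeddings
(the representatives `τ₁, τ₂, τ₃` of a CM type of a sextic CM field). -/
structure IsCMFrame (τ : Fin 3 → (K →+* ℂ)) : Prop where
  /-- `τ ν ≠ τ μ` for `ν ≠ μ`. -/
  injective : Function.Injective τ
  /-- No `τ ν` is the conjugate of a `τ μ`. -/
  ne_conjugate : ∀ ν μ, τ ν ≠ conjugate (τ μ)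
  /-- Every embedding is some `τ ν` or its conjugate. -/
  exhaustive : ∀ φ : K →+* ℂ, ∃ ν, φ = τ ν ∨ φ = conjugate (τ ν)

/-- The CM type of the cube vertex `b`: `τ ν` where `b ν = true`, `conjugate (τ ν)` where
`b ν = false`. -/
def cubeType (τ : Fin 3 → (K →+* ℂ)) (b : Fin 3 → Bool) : Set (K →+* ℂ) :=
  Set.range fun ν => if b ν then τ ν else conjugate (τ ν)

/-- `τ ν ∈ cubeType τ b ↔ b ν = true` (for a CM frame). -/
theorem apply_mem_cubeType_iff {τ : Fin 3 → (K →+* ℂ)} (hτ : IsCMFrame τ) (b : Fin 3 → Bool)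
    (ν : Fin 3) : τ ν ∈ cubeType τ b ↔ b ν = true := by
  constructor
  · rintro ⟨μ, hμ⟩
    by_cases hb : b μ = true
    · simp only [hb, if_true] at hμ
      rw [hτ.injective hμ] at hb
      exact hb
    · simp [hb] at hμ
      exact absurd hμ.symm (hτ.ne_conjugate ν μ)
  · intro hb
    exact ⟨ν, by simp [hb]⟩

/-- `conjugate (τ ν) ∈ cubeType τ b ↔ b ν = false` (for a CM frame). -/
theorem conjugate_apply_mem_cubeType_iff {τ : Fin 3 → (K →+* ℂ)} (hτ : IsCMFrame τ)
    (b : Fin 3 → Bool) (ν : Fin 3) : conjugate (τ ν) ∈ cubeType τ b ↔ b ν = false := by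
  constructor
  · rintro ⟨μ, hμ⟩
    by_cases hb : b μ = true
    · simp only [hb, if_true] at hμ
      exact absurd hμ (hτ.ne_conjugate μ ν)
    · simp [hb] at hμ
      rw [hτ.injective hμ] at hb
      simpa using hb
  · intro hb
    exact ⟨ν, by simp [hb]⟩

/-- The cube vertices are CM types. -/
theorem isCMType_cubeType {τ : Fin 3 → (K →+* ℂ)} (hτ : IsCMFrame τ) (b : Fin 3 → Bool) :
    IsCMType K (cubeType τ b) := by
  intro φ
  obtain ⟨ν, hφ | hφ⟩ := hτ.exhaustive φ
  · subst hφ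
    rw [xor_iff_not_iff, apply_mem_cubeType_iff hτ, conjugate_apply_mem_cubeType_iff hτ]
    cases b ν <;> simp
  · subst hφ
    rw [xor_iff_not_iff, conjugate_apply_mem_cubeType_iff hτ, conjugate_conjugate,
      apply_mem_cubeType_iff hτ]
    cases b ν <;> simp

/-- Agreement of two vertex types at `τ ν` is agreement of the bits. -/
theorem agree_apply_iff {τ : Fin 3 → (K →+* ℂ)} (hτ : IsCMFrame τ) (b b' : Fin 3 → Bool)
    (ν : Fin 3) : (τ ν ∈ cubeType τ b ↔ τ ν ∈ cubeType τ b') ↔ (b ν = b' ν) := by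
  rw [apply_mem_cubeType_iff hτ, apply_mem_cubeType_iff hτ]
  cases b ν <;> cases b' ν <;> simp

/-- Agreement of two vertex types at `conjugate (τ ν)` is agreement of the bits. -/
theorem agree_conjugate_apply_iff {τ : Fin 3 → (K →+* ℂ)} (hτ : IsCMFrame τ)
    (b b' : Fin 3 → Bool) (ν : Fin 3) :
    (conjugate (τ ν) ∈ cubeType τ b ↔ conjugate (τ ν) ∈ cubeType τ b') ↔ (b ν = b' ν) := by
  rw [conjugate_apply_mem_cubeType_iff hτ, conjugate_apply_mem_cubeType_iff hτ]
  cases b ν <;> cases b' ν <;> simp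

/-- **Equal bit-wise `xor`s give the same flip pattern.** -/
theorem sameFlip_cubeType {τ : Fin 3 → (K →+* ℂ)} (hτ : IsCMFrame τ)
    {b₁ b₁' b₂ b₂' : Fin 3 → Bool} (h : ∀ ν, xor (b₁ ν) (b₁' ν) = xor (b₂ ν) (b₂' ν)) :
    SameFlip (cubeType τ b₁) (cubeType τ b₁') (cubeType τ b₂) (cubeType τ b₂') := by
  intro φ
  obtain ⟨ν, hφ | hφ⟩ := hτ.exhaustive φ
  · subst hφ
    rw [agree_apply_iff hτ, agree_apply_iff hτ]
    have := h ν
    revert this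
    cases b₁ ν <;> cases b₁' ν <;> cases b₂ ν <;> cases b₂' ν <;> simp
  · subst hφ
    rw [agree_conjugate_apply_iff hτ, agree_conjugate_apply_iff hτ]
    have := h ν
    revert this
    cases b₁ ν <;> cases b₁' ν <;> cases b₂ ν <;> cases b₂' ν <;> simp

open Summit.Ventures.HodgeRepro2.T5DatumSimilitude in
/-- The datum's vertex pairs `(111, 101)` and `(100, 110)` have the same flip pattern
(`T5DatumSimilitude.xor_consistency`). -/
theorem sameFlip_datum {τ : Fin 3 → (K →+* ℂ)} (hτ : IsCMFrame τ) :
    SameFlip (cubeType τ t111) (cubeType τ t101) (cubeType τ t100) (cubeType τ t110) :=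
  sameFlip_cubeType hτ (fun ν => congrFun xor_consistency ν)

open Summit.Ventures.HodgeRepro2.T5DatumSimilitude in
/-- The types `111` and `101` differ exactly at `τ₂` and its conjugate. -/
theorem not_agree_datum_iff {τ : Fin 3 → (K →+* ℂ)} (hτ : IsCMFrame τ) (φ : K →+* ℂ) :
    ¬ (φ ∈ cubeType τ t111 ↔ φ ∈ cubeType τ t101) ↔ (φ = τ 1 ∨ φ = conjugate (τ 1)) := by
  obtain ⟨ν, hφ | hφ⟩ := hτ.exhaustive φ
  · subst hφ
    rw [agree_apply_iff hτ]
    constructor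
    · intro h
      left
      have : ν = 1 := by
        revert h
        fin_cases ν <;> decide
      rw [this]
    · rintro (h | h)
      · rw [hτ.injective h]; decide
      · exact absurd h (hτ.ne_conjugate ν 1)
  · subst hφ
    rw [agree_conjugate_apply_iff hτ]
    constructor
    · intro h
      right
      have : ν = 1 := by
        revert h
        fin_cases ν <;> decide
      rw [this]
    · rintro (h | h)
      · exact absurd h.symm (hτ.ne_conjugate 1 ν)
      · have h' := congrArg conjugate h
        rw [conjugate_conjugate, conjugate_conjugate] at h'
        rw [hτ.injective h']; decide

section CMField

variable [NumberField K] [IsCMField K]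

open Summit.Ventures.HodgeRepro2.T5DatumSimilitude in
/-- **Lemma N.2 for the datum's vertices.** For a CM frame `τ` and admissible `e₁₁₁` (for
`111`), `e₁₀₀` (for `100`) there is a totally real `u ≠ 0` with `u e₁₁₁` admissible for `101`,
`u⁻¹ e₁₀₀` admissible for `110`, `(u e₁₁₁)(u⁻¹ e₁₀₀) = e₁₁₁ e₁₀₀` exactly, and `Re φ(u) < 0`
exactly for `φ ∈ {τ₂, τ̄₂}` — the sign vector `(+, −, +)` of N2.1(b). -/
theorem lemma_N2_datum {τ : Fin 3 → (K →+* ℂ)} (hτ : IsCMFrame τ) {e₁ e₂ : K}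
    (he₁ : IsLiuSignElement K (cubeType τ t111) e₁)
    (he₂ : IsLiuSignElement K (cubeType τ t100) e₂) :
    ∃ u : K, star u = u ∧ u ≠ 0 ∧
      IsLiuSignElement K (cubeType τ t101) (u * e₁) ∧
      IsLiuSignElement K (cubeType τ t110) (u⁻¹ * e₂) ∧
      (u * e₁) * (u⁻¹ * e₂) = e₁ * e₂ ∧
      ∀ φ : K →+* ℂ, (φ u).re < 0 ↔ (φ = τ 1 ∨ φ = conjugate (τ 1)) := by
  obtain ⟨u, hu, hu0, h101, h110, hprod, hsign⟩ :=
    lemma_N2 (isCMType_cubeType hτ t111) (isCMType_cubeType hτ t101)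
      (isCMType_cubeType hτ t100) (sameFlip_datum hτ) he₁ he₂
  refine ⟨u, hu, hu0, h101, h110, hprod, fun φ => ?_⟩
  rw [hsign φ, not_agree_datum_iff hτ]

/-! ## Row N2.2.6 on the field: the sign vectors of admissible elements are the vertex bits -/

/-- The sign vector of `e` at the three places of the frame: `sign (Im τ_j(e))`. -/
noncomputable def signVecOf (τ : Fin 3 → (K →+* ℂ)) (e : K) : Fin 3 → SignType :=
  fun j => SignType.sign (τ j e).im

/-- An element admissible for the vertex `b` has sign `−` at `τ_j` where `b j = true` and `+`
where `b j = false`. -/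
theorem signVecOf_apply_of_isLiuSignElement {τ : Fin 3 → (K →+* ℂ)} (hτ : IsCMFrame τ)
    {b : Fin 3 → Bool} {e : K} (he : IsLiuSignElement K (cubeType τ b) e) (j : Fin 3) :
    signVecOf τ e j = if b j = true then SignType.neg else SignType.pos := by
  obtain ⟨-, -, he3⟩ := he
  unfold signVecOf
  by_cases hb : b j = true
  · rw [if_pos hb, SignType.neg_eq_neg_one]
    exact sign_neg (he3 _ ((apply_mem_cubeType_iff hτ b j).mpr hb))
  · rw [if_neg hb, SignType.pos_eq_one]
    have h := he3 _ ((conjugate_apply_mem_cubeType_iff hτ b j).mpr (by simpa using hb))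
    rw [im_conjugate] at h
    exact sign_pos (by linarith)

/-- The sign vector of an element admissible for the vertex `b`, as a function. -/
theorem signVecOf_eq_of_isLiuSignElement {τ : Fin 3 → (K →+* ℂ)} (hτ : IsCMFrame τ)
    {b : Fin 3 → Bool} {e : K} (he : IsLiuSignElement K (cubeType τ b) e) :
    signVecOf τ e = fun j => if b j = true then SignType.neg else SignType.pos :=
  funext (signVecOf_apply_of_isLiuSignElement hτ he)

open Summit.Ventures.HodgeRepro2.T5DatumSimilitude in
/-- The vertex-bit sign functions of the datum are the model's sign vectors. -/
theorem vertexSign_eq :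
    ((fun j => if t111 j = true then SignType.neg else SignType.pos) = s111) ∧
    ((fun j => if t100 j = true then SignType.neg else SignType.pos) = s100) ∧
    ((fun j => if t101 j = true then SignType.neg else SignType.pos) = s101) ∧
    ((fun j => if t110 j = true then SignType.neg else SignType.pos) = s110) := by
  decide

open Summit.Ventures.HodgeRepro2.T5DatumSimilitude in
/-- **Row N2.2.6 on the field:** for admissible `e₁₁₁, e₁₀₀, e₁₀₁, e₁₁₀` (e.g. those of
`lemma_N2_datum`), the two pairs `⟨e₁₁₁⟩ ⊥ ⟨e₁₀₀⟩` and `⟨e₁₀₁⟩ ⊥ ⟨e₁₁₀⟩` have the same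
signature `(0,2), (1,1), (1,1)` at the three real places. -/
theorem signature_datum {τ : Fin 3 → (K →+* ℂ)} (hτ : IsCMFrame τ) {e₁ e₂ e₃ e₄ : K}
    (he₁ : IsLiuSignElement K (cubeType τ t111) e₁)
    (he₂ : IsLiuSignElement K (cubeType τ t100) e₂)
    (he₃ : IsLiuSignElement K (cubeType τ t101) e₃)
    (he₄ : IsLiuSignElement K (cubeType τ t110) e₄) :
    signature (signVecOf τ e₁) (signVecOf τ e₂) = ![(0, 2), (1, 1), (1, 1)] ∧
    signature (signVecOf τ e₃) (signVecOf τ e₄) = ![(0, 2), (1, 1), (1, 1)] := by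
  rw [signVecOf_eq_of_isLiuSignElement hτ he₁, signVecOf_eq_of_isLiuSignElement hτ he₂,
    signVecOf_eq_of_isLiuSignElement hτ he₃, signVecOf_eq_of_isLiuSignElement hτ he₄,
    vertexSign_eq.1, vertexSign_eq.2.1, vertexSign_eq.2.2.1, vertexSign_eq.2.2.2]
  exact ⟨signature_A, signature_B⟩

end CMField

end Summit.Ventures.HodgeRepro2.T5CubeTypes
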